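import Literature.Probability.Moments.MGFConvergenceMoments
import Summits.QuantumFields.YangMills.Theorems.ParabolicTrajectoryContinuumLimitOnTrajectoryFlowDefs

/-!
# Stub `stub_curtiss` (line curtiss-flowed-free-energies of crux ContinuumLimitOnTrajectory) PROVED

The registered stub `stub_curtiss : Statement.stub_curtiss` (= `CurtissTheorem`, Curtiss 1942 Thm 3,
multivariate: probability laws on `ℝᵐ` whose moment generating functions are finite and converge on
an open cube around `0` have convergent mixed moments of every order) is the Literature theorem
`Literature.Probability.Moments.tendsto_integral_prod_pow_of_tendsto_mgf`
(`Literature/Probability/Moments/MGFConvergenceMoments.lean`), which does not even need the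
probability normalisation.
-/

namespace Summit.QuantumFields.YangMills.Cruxes.ContinuumLimitOnTrajectory.CurtissFlowedFreeEnergies

/-- REGISTERED STUB `stub_curtiss` (Curtiss' theorem, multivariate moment form): an instance of
`Literature.Probability.Moments.tendsto_integral_prod_pow_of_tendsto_mgf` (the probability
hypothesis of `CurtissTheorem` is not needed). [cite: Curtiss1942, Thm 3] -/
theorem stub_curtiss : Statement.stub_curtiss :=
  fun m ν _ δ hδ h p =>
    Literature.Probability.Moments.tendsto_integral_prod_pow_of_tendsto_mgf m ν δ hδ h p

end Summit.QuantumFields.YangMills.Cruxes.ContinuumLimitOnTrajectory.CurtissFlowedFreeEnergies
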